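import Summits.PneNP.PneNP.Theorems.Nc03AvoidResidualCoreCandFewHeadsRungFPDecode

/-!
# Route Nc03AvoidResidualCore — few-heads rung for `CandAvoidLinearFP` (C₁), typed version, part 2/3: the K1/K3 certificate search on decoded outputs and its correctness

Part 2 of `Nc03AvoidResidualCoreCandFewHeadsRungFP{Decode,Search,}.lean` (tribunal-w, D-0033 T3, item
`stmt-PneNP-20226`). On the decoded output list `trips I : List (ℕ × ℕ × ℕ)` (head, data, data) the two
local certificates of `Nc03AvoidResidualCoreCandFewHeadsRung` are re-expressed as Boolean tests on
NATURAL-NUMBER data, so that part 3 can run them inside an `FP` string function: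

* K1 `parN` — two distinct outputs with the same head and the same unordered data pair; the pattern
  `10` on them is never attained (`sound_par`, from `not_mem_range_of_parallel`);
* K3 `motN` — four outputs `j₁, j₂, j₃, j₄` with a common head whose data pairs form the path motif
  `{a,b}, {b,c}, {c,·}, {a,·}`, written in ORIENTATION form (`linkO`: for some orientations `o₁, o₂` of
  the data pairs of `j₁, j₂` the consecutive endpoints agree); the pattern `1010` is never attained
  (`sound_mot`, from `not_mem_range_of_motif`).

Completeness is transported from `exists_certificate` (more than `headCount·(n−1)` outputs force a
K1 pair or a K3 quadruple) via `parN_of_parallelB`, `motN_of_motifB`. The searches run over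
`[0,m)²` / `[0,m)⁴` with `List.find?`; the ANSWER string is `10` on the K1 pair found, else `1010` on
the K3 quadruple found, else `0ᵐ` (`answer`, `answer_not_mem_range`), and the string function of the
rung is `avoidStr w = answer (token 1 of w) (outputs read off the tokens of w)` (`avoidStr_encode`).

Restricted-model algorithmic rung of the range-avoidance ladder; no bearing on `P` versus `NP`.
-/

set_option linter.dupNamespace false -- `Summit.PneNP.PneNP.…`: summit = sub-problem name (D-0017 single-conjunct layout)

namespace Summit.PneNP.PneNP.Theorems.Nc03AvoidResidualCoreCandFewHeadsRungFP

open Literature.Computability.Complexity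
open Summit.PneNP.PneNP.Theorems.Nc03AvoidResidualCoreCandFewHeadsRung

variable {n m : ℕ}

/-! ## The certificates on token data -/

/-- Entry `j` of the triple list. -/
def tri (L : List (ℕ × ℕ × ℕ)) (j : ℕ) : ℕ × ℕ × ℕ := L.getD j (0, 0, 0)

/-- Entry `j < m` of `trips I` is output `j`. -/
@[simp] theorem tri_trips (I : LocalMap 3 n m) (j : Fin m) : tri (trips I) j.val = tripOf I j := by
  have hj : j.val < ((List.finRange m).map (tripOf I)).length := by simp
  rw [tri, trips, List.getD_eq_getElem _ _ hj, List.getElem_map, List.getElem_finRange]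
  rfl

/-- K1 on token data: distinct outputs, equal heads, equal unordered data pairs. -/
def parN (L : List (ℕ × ℕ × ℕ)) (p : ℕ × ℕ) : Bool :=
  !decide (p.1 = p.2) && decide ((tri L p.1).1 = (tri L p.2).1) &&
    (decide ((tri L p.1).2.1 = (tri L p.2).2.1) && decide ((tri L p.1).2.2 = (tri L p.2).2.2) ||
      decide ((tri L p.1).2.1 = (tri L p.2).2.2) && decide ((tri L p.1).2.2 = (tri L p.2).2.1))

/-- The data pair of a triple in orientation `o`. -/
def eO (t : ℕ × ℕ × ℕ) : Bool → ℕ × ℕ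
  | false => (t.2.1, t.2.2)
  | true => (t.2.2, t.2.1)

/-- The K3 link in orientations `o₁, o₂`: data pairs `(a,b), (b,c)` of `j₁, j₂`, `c ∈` data of `j₃`,
`a ∈` data of `j₄`. -/
def linkO (L : List (ℕ × ℕ × ℕ)) (q : (ℕ × ℕ) × (ℕ × ℕ)) (o₁ o₂ : Bool) : Bool :=
  decide ((eO (tri L q.1.1) o₁).2 = (eO (tri L q.1.2) o₂).1) &&
    (decide ((eO (tri L q.1.2) o₂).2 = (tri L q.2.1).2.1) || decide ((eO (tri L q.1.2) o₂).2 = (tri L q.2.1).2.2)) &&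
    (decide ((eO (tri L q.1.1) o₁).1 = (tri L q.2.2).2.1) || decide ((eO (tri L q.1.1) o₁).1 = (tri L q.2.2).2.2))

/-- K3 on token data: a common head, the index side conditions, and a link in some orientation. -/
def motN (L : List (ℕ × ℕ × ℕ)) (q : (ℕ × ℕ) × (ℕ × ℕ)) : Bool :=
  decide ((tri L q.1.2).1 = (tri L q.1.1).1) && decide ((tri L q.2.1).1 = (tri L q.1.1).1) &&
    decide ((tri L q.2.2).1 = (tri L q.1.1).1) &&
    !decide (q.1.2 = q.1.1) && !decide (q.1.2 = q.2.1) && !decide (q.2.2 = q.1.1) && !decide (q.2.2 = q.2.1) &&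
    (linkO L q false false || linkO L q false true || linkO L q true false || linkO L q true true)

/-- The data pair of output `j` in orientation `o`, as input positions. -/
def vO (I : LocalMap 3 n m) (j : Fin m) : Bool → Fin n × Fin n
  | false => (I.vars j 1, I.vars j 2)
  | true => (I.vars j 2, I.vars j 1)

/-- The data pair is the unordered pair of either orientation. -/
theorem pset_vO (I : LocalMap 3 n m) (j : Fin m) (o : Bool) : pset I j = {(vO I j o).1, (vO I j o).2} := by
  cases o
  · rfl
  · exact Finset.pair_comm _ _

/-- Orienting the token triple of output `j` = orienting its data pair. -/
@[simp] theorem eO_tripOf (I : LocalMap 3 n m) (j : Fin m) (o : Bool) :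
    eO (tripOf I j) o = (((vO I j o).1).val, ((vO I j o).2).val) := by
  cases o <;> rfl

/-- K1 on token data is sound. -/
theorem sound_par {I : LocalMap 3 n m} (hI : I.IsPure candPred) {j j' : Fin m}
    (h : parN (trips I) (j.val, j'.val) = true) {y : Fin m → Bool}
    (hy : ∀ i, y i = decide (i.val = j.val)) : y ∉ I.range := by
  simp only [parN, tri_trips, tripOf_fst, tripOf_snd_fst, tripOf_snd_snd, Bool.and_eq_true,
    Bool.or_eq_true, Bool.not_eq_true', decide_eq_true_eq, decide_eq_false_iff_not] at h
  obtain ⟨⟨hne, hh⟩, hp⟩ := h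
  have hp' : pset I j = pset I j' := by
    rcases hp with ⟨h1, h2⟩ | ⟨h1, h2⟩
    · rw [pset, pset, Fin.ext h1, Fin.ext h2]
    · rw [pset, pset, Fin.ext h1, Fin.ext h2, Finset.pair_comm]
  refine not_mem_range_of_parallel hI (Fin.ext hh) hp' (by rw [hy]; simp) ?_
  rw [hy]
  exact decide_eq_false fun h => hne h.symm

/-- A K3 link on token data is sound. -/
theorem sound_link {I : LocalMap 3 n m} (hI : I.IsPure candPred) {j1 j2 j3 j4 : Fin m} (o₁ o₂ : Bool)
    (hl : linkO (trips I) ((j1.val, j2.val), (j3.val, j4.val)) o₁ o₂ = true)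
    (h2 : I.vars j2 0 = I.vars j1 0) (h3 : I.vars j3 0 = I.vars j1 0) (h4 : I.vars j4 0 = I.vars j1 0)
    {y : Fin m → Bool} (y1 : y j1 = true) (y2 : y j2 = false) (y3 : y j3 = true) (y4 : y j4 = false) :
    y ∉ I.range := by
  simp only [linkO, tri_trips, eO_tripOf, tripOf_snd_fst, tripOf_snd_snd, Bool.and_eq_true,
    Bool.or_eq_true, decide_eq_true_eq] at hl
  obtain ⟨⟨hb, hc⟩, ha⟩ := hl
  have p1 := pset_vO I j1 o₁
  have p2 := pset_vO I j2 o₂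
  rw [← Fin.ext hb] at p2
  obtain ⟨d, p3⟩ : ∃ d, pset I j3 = {(vO I j2 o₂).2, d} := by
    rcases hc with h | h
    · exact ⟨I.vars j3 2, by rw [Fin.ext h]; rfl⟩
    · exact ⟨I.vars j3 1, by rw [Fin.ext h, pset, Finset.pair_comm]⟩
  obtain ⟨f, p4⟩ : ∃ f, pset I j4 = {(vO I j1 o₁).1, f} := by
    rcases ha with h | h
    · exact ⟨I.vars j4 2, by rw [Fin.ext h]; rfl⟩
    · exact ⟨I.vars j4 1, by rw [Fin.ext h, pset, Finset.pair_comm]⟩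
  exact not_mem_range_of_motif hI h2 h3 h4 p1 p2 p3 p4 y1 y2 y3 y4

/-- K3 on token data is sound. -/
theorem sound_mot {I : LocalMap 3 n m} (hI : I.IsPure candPred) {j1 j2 j3 j4 : Fin m}
    (h : motN (trips I) ((j1.val, j2.val), (j3.val, j4.val)) = true) {y : Fin m → Bool}
    (hy : ∀ i, y i = (decide (i.val = j1.val) || decide (i.val = j3.val))) : y ∉ I.range := by
  simp only [motN, tri_trips, tripOf_fst, Bool.and_eq_true, Bool.or_eq_true, Bool.not_eq_true',
    decide_eq_true_eq, decide_eq_false_iff_not] at h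
  obtain ⟨⟨⟨⟨⟨⟨⟨h2, h3⟩, h4⟩, n21⟩, n23⟩, n41⟩, n43⟩, hlink⟩ := h
  obtain ⟨o₁, o₂, hl⟩ : ∃ o₁ o₂, linkO (trips I) ((j1.val, j2.val), (j3.val, j4.val)) o₁ o₂ = true := by
    rcases hlink with ((h | h) | h) | h <;> exact ⟨_, _, h⟩
  refine sound_link hI o₁ o₂ hl (Fin.ext h2) (Fin.ext h3) (Fin.ext h4) ?_ ?_ ?_ ?_
  · rw [hy]; simp
  · rw [hy]; simp only [Bool.or_eq_false_iff, decide_eq_false_iff_not]; exact ⟨n21, n23⟩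
  · rw [hy]; simp
  · rw [hy]; simp only [Bool.or_eq_false_iff, decide_eq_false_iff_not]; exact ⟨n41, n43⟩

/-- Completeness transfer, K1: a certificate of the explicit rung is seen on token data. -/
theorem parN_of_parallelB {I : LocalMap 3 n m} {p : Fin m × Fin m} (h : parallelB I p = true) :
    parN (trips I) (p.1.val, p.2.val) = true := by
  simp only [parallelB, decide_eq_true_eq] at h
  obtain ⟨hne, hh, hp⟩ := h
  simp only [parN, tri_trips, tripOf_fst, tripOf_snd_fst, tripOf_snd_snd, Bool.and_eq_true,
    Bool.or_eq_true, Bool.not_eq_true', decide_eq_true_eq, decide_eq_false_iff_not]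
  refine ⟨⟨fun h => hne (Fin.ext h), by rw [hh]⟩, ?_⟩
  rcases pair_eq_pair hp with ⟨h1, h2⟩ | ⟨h1, h2⟩
  · exact Or.inl ⟨by rw [h1], by rw [h2]⟩
  · exact Or.inr ⟨by rw [h1], by rw [h2]⟩

/-- Completeness transfer, K3. -/
theorem motN_of_motifB {I : LocalMap 3 n m} {q : (Fin m × Fin m) × (Fin m × Fin m)}
    (h : motifB I q = true) :
    motN (trips I) ((q.1.1.val, q.1.2.val), (q.2.1.val, q.2.2.val)) = true := by
  simp only [motifB, decide_eq_true_eq] at h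
  obtain ⟨h2, h3, h4, n21, n23, n41, n43, a, -, b, -, c, -, d, -, f, -, p1, p2, p3, p4⟩ := h
  obtain ⟨o₁, ho₁⟩ : ∃ o₁, vO I q.1.1 o₁ = (a, b) := by
    rcases pair_eq_pair p1 with ⟨h1, h2⟩ | ⟨h1, h2⟩
    · exact ⟨false, Prod.ext h1 h2⟩
    · exact ⟨true, Prod.ext h2 h1⟩
  obtain ⟨o₂, ho₂⟩ : ∃ o₂, vO I q.1.2 o₂ = (b, c) := by
    rcases pair_eq_pair p2 with ⟨h1, h2⟩ | ⟨h1, h2⟩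
    · exact ⟨false, Prod.ext h1 h2⟩
    · exact ⟨true, Prod.ext h2 h1⟩
  have hl : linkO (trips I) ((q.1.1.val, q.1.2.val), (q.2.1.val, q.2.2.val)) o₁ o₂ = true := by
    simp only [linkO, tri_trips, eO_tripOf, ho₁, ho₂, tripOf_snd_fst, tripOf_snd_snd, Bool.and_eq_true,
      Bool.or_eq_true, decide_eq_true_eq]
    refine ⟨⟨trivial, ?_⟩, ?_⟩
    · rcases pair_eq_pair p3 with ⟨h1, -⟩ | ⟨-, h1⟩
      · exact Or.inl (by rw [h1])
      · exact Or.inr (by rw [h1])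
    · rcases pair_eq_pair p4 with ⟨h1, -⟩ | ⟨-, h1⟩
      · exact Or.inl (by rw [h1])
      · exact Or.inr (by rw [h1])
  simp only [motN, tri_trips, tripOf_fst, Bool.and_eq_true, Bool.or_eq_true, Bool.not_eq_true',
    decide_eq_true_eq, decide_eq_false_iff_not]
  refine ⟨⟨⟨⟨⟨⟨⟨by rw [h2], by rw [h3]⟩, by rw [h4]⟩, fun h => n21 (Fin.ext h)⟩,
    fun h => n23 (Fin.ext h)⟩, fun h => n41 (Fin.ext h)⟩, fun h => n43 (Fin.ext h)⟩, ?_⟩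
  cases o₁ <;> cases o₂ <;> simp [hl]

/-! ## The answer string and its correctness -/

/-- All output pairs, as naturals. -/
def pairsR (m : ℕ) : List (ℕ × ℕ) := (List.range m).product (List.range m)

/-- All output quadruples `((j₁, j₂), (j₃, j₄))`. -/
def quadsR (m : ℕ) : List ((ℕ × ℕ) × (ℕ × ℕ)) := (pairsR m).product (pairsR m)

/-- The answer `0ᵐ`. -/
def ansNone (m : ℕ) : List Bool := (List.range m).map fun _ => false

/-- The answer on a K3 quadruple (`1` exactly on its first and third output), else `0ᵐ`. -/
def ansQuad (m : ℕ) : Option ((ℕ × ℕ) × (ℕ × ℕ)) → List Bool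
  | some q => (List.range m).map fun i => decide (i = q.1.1) || decide (i = q.2.1)
  | none => ansNone m

/-- The answer on a K1 pair (`1` exactly on its first output), else the fallback. -/
def ansPair (m : ℕ) (fb : List Bool) : Option (ℕ × ℕ) → List Bool
  | some p => (List.range m).map fun i => decide (i = p.1)
  | none => fb

/-- **The answer on token data**: K1 search, then K3 search, then `0ᵐ`. -/
def answer (m : ℕ) (L : List (ℕ × ℕ × ℕ)) : List Bool :=
  ansPair m (ansQuad m ((quadsR m).find? (motN L))) ((pairsR m).find? (parN L))

/-- Reading out a tabulated answer string. -/
theorem readOut_map_range (g : ℕ → Bool) (i : Fin m) : readOut m ((List.range m).map g) i = g i.val := by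
  simp [readOut]

/-- **Correctness of the answer** on pure `CAND` instances with more than `headCount·(n−1)` outputs. -/
theorem answer_not_mem_range {I : LocalMap 3 n m} (hI : I.IsPure candPred)
    (hm : headCount I * (n - 1) < m) : readOut m (answer m (trips I)) ∉ I.range := by
  unfold answer
  cases hp : (pairsR m).find? (parN (trips I)) with
  | some p =>
    obtain ⟨a, b⟩ := p
    have hP := List.find?_some hp
    obtain ⟨ha, hb⟩ := List.pair_mem_product.mp (List.mem_of_find?_eq_some hp)
    rw [List.mem_range] at ha hb
    refine sound_par hI (j := ⟨a, ha⟩) (j' := ⟨b, hb⟩) hP ?_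
    intro i
    exact readOut_map_range _ i
  | none =>
    cases hq : (quadsR m).find? (motN (trips I)) with
    | some q =>
      obtain ⟨⟨a, b⟩, ⟨c, e⟩⟩ := q
      have hQ := List.find?_some hq
      obtain ⟨hab, hce⟩ := List.pair_mem_product.mp (List.mem_of_find?_eq_some hq)
      obtain ⟨ha, hb⟩ := List.pair_mem_product.mp hab
      obtain ⟨hc, he⟩ := List.pair_mem_product.mp hce
      rw [List.mem_range] at ha hb hc he
      refine sound_mot hI (j1 := ⟨a, ha⟩) (j2 := ⟨b, hb⟩) (j3 := ⟨c, hc⟩) (j4 := ⟨e, he⟩) hQ ?_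
      intro i
      exact readOut_map_range _ i
    | none =>
      exfalso
      rcases exists_certificate hI hm with ⟨p, hP⟩ | ⟨q, hQ⟩
      · exact List.find?_eq_none.mp hp (p.1.val, p.2.val)
          (List.pair_mem_product.mpr ⟨List.mem_range.mpr p.1.isLt, List.mem_range.mpr p.2.isLt⟩)
          (parN_of_parallelB hP)
      · exact List.find?_eq_none.mp hq ((q.1.1.val, q.1.2.val), (q.2.1.val, q.2.2.val))
          (List.pair_mem_product.mpr
            ⟨List.pair_mem_product.mpr ⟨List.mem_range.mpr q.1.1.isLt, List.mem_range.mpr q.1.2.isLt⟩,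
              List.pair_mem_product.mpr ⟨List.mem_range.mpr q.2.1.isLt, List.mem_range.mpr q.2.2.isLt⟩⟩)
          (motN_of_motifB hQ)

/-- **The avoider as a string function**: tokenize, read the outputs, answer. -/
def avoidStr (w : List Bool) : List Bool := answer ((runs w).getD 1 0) (tripsTok (runs w))

/-- **On the code of a pure `CAND` instance, `avoidStr` is the answer on its outputs.** -/
theorem avoidStr_encode {I : LocalMap 3 n m} (hI : I.IsPure candPred) :
    avoidStr I.encode = answer m (trips I) := by
  rw [avoidStr, runs_encode hI, toks_getD_one, tripsTok_toks]

end Summit.PneNP.PneNP.Theorems.Nc03AvoidResidualCoreCandFewHeadsRungFP
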